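import Summits.QuantumFields.QCD.Theorems.ExtinctionBuildsQCD.Negative.CoercivityCeiling

/-!
# `ExtinctionBuildsQCD` (crux stmt-QuantumFields-18064, RESTATED 2026-08-17 as SD⁺ → THR) — negative-side
# support: the EXTENSIVE two-sided pin (what TIGHT⁺ ∧ EXTINCT hand a bridge prover)

Cdisprove seat g2 (2026-08-17), §7b/§8 of the standing disprover's work file
`Cruxes/ExtinctionBuildsQCD/Disproof.lean`.  The restatement replaced the filed pin TIGHT (floor `1`) by
TIGHT⁺, whose floor is `max 1 (η (a_k(2L_k+1))²)` — the Leutwyler–Smilga `√V_phys` scale.  This module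
records, as theorems about the HYPOTHESIS of the restated bridge, what that buys:

* `tendsto_tightFloor_atTop` — for EVERY regularisation the floor diverges (`a_k L_k → ∞` is a structure
  field), so TIGHT⁺ is TIGHT with an unbounded right-hand side; `tight_of_tightPlus'`.
* `tightRatio_le_mean_add_extinctRatio` — the one-line mechanism: any pointwise budget
  `|index|·W ≤ X·W + (EXTINCT integrand)·W` by a bounded measurable count `X` integrates to
  `tightRatio ≤ E₊[X] + extinctRatio`; instantiated with the three currencies of the filed analysis
  (Hermitian WINDOW at the flavour mass, real-mode BAND at the line, unitary SHELL), whose pointwise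
  budgets (`Negative/TwoSidedPin`'s `tightIntegrand_mul_le_{window,band,shell}_add_extinct_mul`, from
  `Negative/WeylWindow` / `Negative/IndexBudget`) are re-derived inside the proofs.
* **`eventually_floor_le_{window,band,shell}Mean`** — for witness data EXTINCT (constant `c`) and TIGHT⁺ at a
  tuple above `M₀ ≥ 0`: for every flavour `f₀`, probe `M > M₀` and `ε > 0`, eventually in `k` the
  phase-quenched mean on the scheme torus of `#{λ(Γ₅D_W(U,m_{f₀}(k),1)) : |λ| ≤ a_k(m_{f₀}+M)/Z_k}` (resp. of
  `#{real λ(D_W(U,0,1)) ∈ [−m_{f₀}(k), −m_crit(k)+a_kM/Z_k]}`, resp. of the shell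
  `c·a_k m_{f₀}/Z_k ≤ |λ| ≤ a_k(m_{f₀}+M)/Z_k`) is `≥ max 1 (η(a_k(2L_k+1))²) − ε`; hence
  `eventually_le_{window,band,shell}Mean`: these means exceed EVERY constant eventually.
* `windowExtinction_extensive_pin` — reading for the sibling crux `WindowExtinction` (whose body IS SD⁺):
  any witness has `c ≤ 1` and delivers the three divergent pins.

MEANING (for the bridge prover and the line's stub `stub_flavouredThreshold`, which consumes TIGHT⁺ in the
flavoured sector): the restated hypothesis hands `≳ η √V_phys` near-zero modes of the Hermitian Wilson
operator AT THE FLAVOUR (unitary) MASS in an `a_k(m_f+M)/Z_k`-window — equivalently as many real modes of the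
massless Wilson operator in the band at the line — while EXTINCT(b) empties only the inner collar
`|λ| < c·a_k m_f/Z_k` (`c ≤ 1`, `Negative/CoercivityCeiling`).  The witness's line is critical with a
DIVERGENT number of near-zero modes per scheme torus (density `≍ η a_k²(2L_k+1)^{-2}` per site, i.e. the
Banks–Casher / Leutwyler–Smilga currency), never a spectral gap at scale `a_k m_f/Z_k`.

Self-contained on `Negative/CoercivityCeiling` (the ratio lemmas of `Negative/TwoSidedPin` and the defs of
`Negative/WithoutTightPlusCollapse` are deliberately not imported: those modules post-date the restatement of
the route file and are not built on the farm; nothing here re-declares their names — this module lives in the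
sub-namespace `…Negative.ExtensivePin`).
References: Leutwyler–Smilga, Phys. Rev. D 46 (1992) 5607; Giusti–Lüscher, JHEP 03 (2009) 013;
Del Debbio–Giusti–Lüscher–Petronzio–Tantalo, JHEP 02 (2006) 011.
-/

noncomputable section

namespace Summit.QuantumFields.QCD.Theorems.ExtinctionBuildsQCD.Negative.ExtensivePin

open scoped BigOperators Topology Classical MeasureTheory Matrix ComplexConjugate
open Filter MeasureTheory Matrix
open Literature.MathematicalPhysics.QuantumLattice Literature.MathematicalPhysics.QuantumFieldTheory
  Literature.Probability.LatticeModels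
open Summit.QuantumFields.QCD.Theses.SpectralDefectExtinction
open Summit.QuantumFields.QCD.Theorems.ExtinctionBuildsQCD.Negative

variable {Nf : ℕ}

/-! ## The floor of TIGHT⁺ -/

/-- **The TIGHT⁺ floor diverges for every regularisation**: `max 1 (η (a_k(2L_k+1))²) → ∞`, because
`a_k L_k → ∞` is a structure field of `QCDRegularisation` and `a_k(2L_k+1) ≥ 2 a_k L_k`. -/
theorem tendsto_tightFloor_atTop (reg : QCDRegularisation Nf) {η : ℝ} (hη : 0 < η) :
    Tendsto (fun k : ℕ => max 1 (η * (reg.a k * (2 * reg.L k + 1 : ℝ)) ^ 2)) atTop atTop := by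
  have h1 : Tendsto (fun k : ℕ => reg.a k * (2 * reg.L k + 1 : ℝ)) atTop atTop := by
    refine tendsto_atTop_mono (fun k => ?_) (reg.tendsto_L.const_mul_atTop' two_pos)
    have ha := (reg.a_pos k).le
    nlinarith
  have h2 : Tendsto (fun k : ℕ => η * (reg.a k * (2 * reg.L k + 1 : ℝ)) ^ 2) atTop atTop :=
    (tendsto_pow_atTop two_ne_zero |>.comp h1).const_mul_atTop hη
  exact tendsto_atTop_mono (fun k => le_max_right _ _) h2


/-- The TIGHT⁺ conjunct of `WindowExtinction` / of the hypothesis of `ExtinctionBuildsQCD`, in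
`Negative.tightRatio` currency (left) and verbatim (right): definitionally the same clause. -/
theorem tightPlus_iff_raw (reg : QCDRegularisation Nf) (M₀ : ℝ) (m : Fin Nf → ℝ) :
    (∃ η : ℝ, 0 < η ∧ ∀ M : ℝ, M₀ < M → ∀ᶠ k : ℕ in Filter.atTop, max 1 (η * (reg.a k * (2 * reg.L k + 1 : ℝ)) ^ 2) ≤ tightRatio reg k (reg.L k) m M) ↔ ∃ η : ℝ, 0 < η ∧ ∀ M : ℝ, M₀ < M → ∀ᶠ k : ℕ in Filter.atTop, max 1 (η * (reg.a k * (2 * reg.L k + 1 : ℝ)) ^ 2) ≤ (∫ U, (|(Multiset.countP (fun z : ℂ => z.re < 0) (spinorLift gammaFive * wilsonDirac (fundamentalRep (Fin 3)) U (reg.mcrit k - reg.a k * M / reg.Zm k) 1).charpoly.roots : ℝ) - 6 * (2 * reg.L k + 1 : ℝ) ^ 4|) * ∏ f : Fin Nf, ‖fermionDet (wilsonDirac (fundamentalRep (Fin 3)) U (reg.mcrit k + reg.a k * m f / reg.Zm k) 1)‖ ∂(wilsonMeasure (d := 4) (L := 2 * reg.L k + 1) (fundamentalRep (Fin 3)) (reg.β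 k))) / (∫ U, ∏ f : Fin Nf, ‖fermionDet (wilsonDirac (fundamentalRep (Fin 3)) U (reg.mcrit k + reg.a k * m f / reg.Zm k) 1)‖ ∂(wilsonMeasure (d := 4) (L := 2 * reg.L k + 1) (fundamentalRep (Fin 3)) (reg.β k))) :=
  Iff.rfl

/-- TIGHT⁺ implies the filed TIGHT (`1 ≤ max 1 _`). -/
theorem tight_of_tightPlus' {reg : QCDRegularisation Nf} {M₀ : ℝ} {m : Fin Nf → ℝ}
    (h : (∃ η : ℝ, 0 < η ∧ ∀ M : ℝ, M₀ < M → ∀ᶠ k : ℕ in Filter.atTop, max 1 (η * (reg.a k * (2 * reg.L k + 1 : ℝ)) ^ 2) ≤ tightRatio reg k (reg.L k) m M)) : Tight Nf reg M₀ m := by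
  obtain ⟨η, -, h⟩ := h
  intro M hM
  filter_upwards [h M hM] with k hk
  exact le_trans (le_max_left _ _) hk

/-- TIGHT⁺ makes `tightRatio` on the scheme torus exceed every constant eventually. -/
theorem eventually_le_tightRatio {reg : QCDRegularisation Nf} {M₀ : ℝ} {m : Fin Nf → ℝ}
    (h : (∃ η : ℝ, 0 < η ∧ ∀ M : ℝ, M₀ < M → ∀ᶠ k : ℕ in Filter.atTop, max 1 (η * (reg.a k * (2 * reg.L k + 1 : ℝ)) ^ 2) ≤ tightRatio reg k (reg.L k) m M)) (C : ℝ) {M : ℝ} (hM : M₀ < M) :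
    ∀ᶠ k : ℕ in Filter.atTop, C ≤ tightRatio reg k (reg.L k) m M := by
  obtain ⟨η, hη, h⟩ := h
  filter_upwards [h M hM, (tendsto_tightFloor_atTop reg hη).eventually_ge_atTop C] with k hk hC
  exact hC.trans hk

/-! ## The mechanism: a pointwise budget integrates to a ratio budget -/

/-- **Pointwise budget ⇒ ratio budget.** If on every gauge field of the torus `(2S+1)⁴` the weighted TIGHT
integrand is at most `X·W + (EXTINCT integrand)·W` for a measurable count `X ≤ N`, then
`tightRatio ≤ E₊[X] + extinctRatio` there. -/
theorem tightRatio_le_mean_add_extinctRatio (reg : QCDRegularisation Nf) (c : ℝ) (k S : ℕ)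
    (m : Fin Nf → ℝ) (M : ℝ) {g : GaugeConfig 4 (2 * S + 1) SU3 → ℕ} (hg : Measurable g) {N : ℕ}
    (hN : ∀ U, g U ≤ N)
    (hpt : ∀ U : GaugeConfig 4 (2 * S + 1) SU3,
      |(Multiset.countP (fun z : ℂ => z.re < 0) (spinorLift gammaFive * wilsonDirac (fundamentalRep (Fin 3)) U (reg.mcrit k - reg.a k * M / reg.Zm k) 1).charpoly.roots : ℝ) - 6 * (2 * S + 1 : ℝ) ^ 4| * ∏ f : Fin Nf, ‖fermionDet (wilsonDirac (fundamentalRep (Fin 3)) U (reg.mcrit k + reg.a k * m f / reg.Zm k) 1)‖ ≤ (g U : ℝ) * ∏ f : Fin Nf, ‖fermionDet (wilsonDirac (fundamentalRep (Fin 3)) U (reg.mcrit k + reg.a k * m f / reg.Zm k) 1)‖ + (∑ f : Fin Nf, ((Multiset.countP (fun z : ℂ => z.im = 0 ∧ z.re < -(reg.mcrit k + reg.a k * m f / reg.Zm k)) (wilsonDirac (fundamentalRep (Fin 3)) U 0 1).charpoly.roots : ℝ) + (Multiset.countP (fun z : ℂ => |z.re| < c * (reg.a k * m f / reg.Zm k))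 (spinorLift gammaFive * wilsonDirac (fundamentalRep (Fin 3)) U (reg.mcrit k + reg.a k * m f / reg.Zm k) 1).charpoly.roots : ℝ))) * ∏ f : Fin Nf, ‖fermionDet (wilsonDirac (fundamentalRep (Fin 3)) U (reg.mcrit k + reg.a k * m f / reg.Zm k) 1)‖) :
    tightRatio reg k S m M ≤ (∫ U, (g U : ℝ) * ∏ f : Fin Nf, ‖fermionDet (wilsonDirac (fundamentalRep (Fin 3)) U (reg.mcrit k + reg.a k * m f / reg.Zm k) 1)‖ ∂(wilsonMeasure (d := 4) (L := 2 * S + 1) (fundamentalRep (Fin 3)) (reg.β k))) / (∫ U, ∏ f : Fin Nf, ‖fermionDet (wilsonDirac (fundamentalRep (Fin 3)) U (reg.mcrit k + reg.a k * m f / reg.Zm k) 1)‖ ∂(wilsonMeasure (d := 4) (L := 2 * S + 1) (fundamentalRep (Fin 3)) (reg.β k))) + extinctRatio reg c k S m := by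
  unfold tightRatio extinctRatio
  rw [← add_div, ← integral_add]
  · refine div_le_div_of_nonneg_right ?_
      (integral_nonneg fun U => Finset.prod_nonneg fun f _ => norm_nonneg _)
    refine integral_mono_of_nonneg (Eventually.of_forall fun U => ?_) ?_ (Eventually.of_forall fun U => hpt U)
    · exact mul_nonneg (abs_nonneg _) (Finset.prod_nonneg fun f _ => norm_nonneg _)
    · exact (integrable_natCount_mul_weight _ _ hg hN).add (integrable_extinctIntegrand reg c k m (reg.β k))
  · exact integrable_natCount_mul_weight _ _ hg hN
  · exact integrable_extinctIntegrand reg c k m (reg.β k)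

/-! ## The extensive pins -/

/-- **THE EXTENSIVE PIN, Hermitian currency.** For witness data `(reg, M₀, c)` EXTINCT and TIGHT⁺ at a tuple `m`
above `M₀ ≥ 0`, every flavour `f₀`, probe `M > M₀` and `ε > 0`: eventually in `k`, on the scheme torus,
`E₊ #{λ(Γ₅D_W(U, m_{f₀}(k), 1)) : |λ| ≤ a_k(m_{f₀}+M)/Z_k} ≥ max 1 (η (a_k(2L_k+1))²) − ε`. -/
theorem eventually_floor_le_windowMean (reg : QCDRegularisation Nf) {M₀ c : ℝ} (hM₀ : 0 ≤ M₀)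
    {m : Fin Nf → ℝ} (hm : ∀ f, M₀ < m f) (hE : Extinct Nf reg c m) {η : ℝ}
    (hT : ∀ M : ℝ, M₀ < M → ∀ᶠ k : ℕ in Filter.atTop,
      max 1 (η * (reg.a k * (2 * reg.L k + 1 : ℝ)) ^ 2) ≤ tightRatio reg k (reg.L k) m M)
    (f₀ : Fin Nf) {M : ℝ} (hM : M₀ < M) {ε : ℝ} (hε : 0 < ε) :
    ∀ᶠ k : ℕ in Filter.atTop, max 1 (η * (reg.a k * (2 * reg.L k + 1 : ℝ)) ^ 2) - ε ≤
      (∫ U, (Multiset.countP (fun z : ℂ => |z.re| ≤ reg.a k * m f₀ / reg.Zm k + reg.a k * M / reg.Zm k) (spinorLift gammaFive * wilsonDirac (fundamentalRep (Fin 3)) U (reg.mcrit k + reg.a k * m f₀ / reg.Zm k) 1).charpoly.roots : ℝ) * ∏ f : Fin Nf, ‖fermionDet (wilsonDirac (fundamentalRep (Fin 3)) U (reg.mcrit k + reg.a k * m f / reg.Zm k) 1)‖ ∂(wilsonMeasure (d := 4) (L := 2 * reg.L k + 1) (fundamentalRep (Fin 3)) (reg.β k))) / (∫ U, ∏ f :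 Fin Nf, ‖fermionDet (wilsonDirac (fundamentalRep (Fin 3)) U (reg.mcrit k + reg.a k * m f / reg.Zm k) 1)‖ ∂(wilsonMeasure (d := 4) (L := 2 * reg.L k + 1) (fundamentalRep (Fin 3)) (reg.β k))) := by
  filter_upwards [hE ε hε, hT M hM] with k hEk hTk
  have hE' : extinctRatio reg c k (reg.L k) m ≤ ε * ((2 * (reg.L k : ℕ) + 1 : ℝ) / (2 * reg.L k + 1)) ^ 4 :=
    hEk (reg.L k) le_rfl
  have hone : ((2 * (reg.L k : ℕ) + 1 : ℝ) / (2 * reg.L k + 1)) = 1 := div_self (by positivity)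
  rw [hone, one_pow, mul_one] at hE'
  have hm0 : 0 ≤ m f₀ := by linarith [hm f₀]
  have hM0 : 0 ≤ M := by linarith
  have hflav : ∀ U : GaugeConfig 4 (2 * reg.L k + 1) SU3, (Multiset.countP (fun z : ℂ => z.im = 0 ∧ z.re < -(reg.mcrit k + reg.a k * m f₀ / reg.Zm k)) (wilsonDirac (fundamentalRep (Fin 3)) U 0 1).charpoly.roots : ℝ) + (Multiset.countP (fun z : ℂ => |z.re| < c * (reg.a k * m f₀ / reg.Zm k)) (spinorLift gammaFive * wilsonDirac (fundamentalRep (Fin 3)) U (reg.mcrit k + reg.a k * m f₀ / reg.Zm k) 1).charpoly.roots : ℝ) ≤ (∑ f : Fin Nf, ((Multiset.countP (fun z : ℂ => z.im = 0 ∧ z.re < -(reg.mcrit k + reg.a k * m f / reg.Zm k)) (wilsonDirac (fundamentalRep (Fin 3)) U 0 1).charpoly.roots : ℝ) + (Multiset.countP (fun z : ℂ => |z.re| < c * (reg.a k * m f / reg.Zm k)) (spinorLift gammaFive * wilsonDirac (fundamentalRep (Fin 3)) U (reg.mcrit k + reg.a k * m f / reg.Zm k) 1).charpoly.roots : ℝ)))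 := fun U =>
    Finset.single_le_sum (f := fun f : Fin Nf => ((Multiset.countP (fun z : ℂ => z.im = 0 ∧ z.re < -(reg.mcrit k + reg.a k * m f / reg.Zm k)) (wilsonDirac (fundamentalRep (Fin 3)) U 0 1).charpoly.roots : ℝ) + (Multiset.countP (fun z : ℂ => |z.re| < c * (reg.a k * m f / reg.Zm k)) (spinorLift gammaFive * wilsonDirac (fundamentalRep (Fin 3)) U (reg.mcrit k + reg.a k * m f / reg.Zm k) 1).charpoly.roots : ℝ)))
      (fun _ _ => add_nonneg (Nat.cast_nonneg _) (Nat.cast_nonneg _)) (Finset.mem_univ f₀)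
  have hsign : ∀ U : GaugeConfig 4 (2 * reg.L k + 1) SU3, (Multiset.countP (fun z : ℂ => z.im = 0 ∧ z.re < -(reg.mcrit k + reg.a k * m f₀ / reg.Zm k)) (wilsonDirac (fundamentalRep (Fin 3)) U 0 1).charpoly.roots : ℝ) ≤ (∑ f : Fin Nf, ((Multiset.countP (fun z : ℂ => z.im = 0 ∧ z.re < -(reg.mcrit k + reg.a k * m f / reg.Zm k)) (wilsonDirac (fundamentalRep (Fin 3)) U 0 1).charpoly.roots : ℝ) + (Multiset.countP (fun z : ℂ => |z.re| < c * (reg.a k * m f / reg.Zm k)) (spinorLift gammaFive * wilsonDirac (fundamentalRep (Fin 3)) U (reg.mcrit k + reg.a k * m f / reg.Zm k) 1).charpoly.roots : ℝ))) := fun U =>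
    le_trans (le_add_of_nonneg_right (Nat.cast_nonneg _)) (hflav U)
  have hpt : ∀ U : GaugeConfig 4 (2 * reg.L k + 1) SU3, |(Multiset.countP (fun z : ℂ => z.re < 0) (spinorLift gammaFive * wilsonDirac (fundamentalRep (Fin 3)) U (reg.mcrit k - reg.a k * M / reg.Zm k) 1).charpoly.roots : ℝ) - 6 * (2 * reg.L k + 1 : ℝ) ^ 4| * ∏ f : Fin Nf, ‖fermionDet (wilsonDirac (fundamentalRep (Fin 3)) U (reg.mcrit k + reg.a k * m f / reg.Zm k) 1)‖ ≤
      (Multiset.countP (fun z : ℂ => |z.re| ≤ reg.a k * m f₀ / reg.Zm k + reg.a k * M / reg.Zm k) (spinorLift gammaFive * wilsonDirac (fundamentalRep (Fin 3)) U (reg.mcrit k + reg.a k * m f₀ / reg.Zm k) 1).charpoly.roots : ℝ) * ∏ f : Fin Nf, ‖fermionDet (wilsonDirac (fundamentalRep (Fin 3)) U (reg.mcrit k + reg.a k * m f / reg.Zm k) 1)‖ + (∑ f : Fin Nf, ((Multiset.countP (fun z : ℂ => z.im = 0 ∧ z.re < -(reg.mcrit k + reg.a k * m f / reg.Zm k))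 (wilsonDirac (fundamentalRep (Fin 3)) U 0 1).charpoly.roots : ℝ) + (Multiset.countP (fun z : ℂ => |z.re| < c * (reg.a k * m f / reg.Zm k)) (spinorLift gammaFive * wilsonDirac (fundamentalRep (Fin 3)) U (reg.mcrit k + reg.a k * m f / reg.Zm k) 1).charpoly.roots : ℝ))) * ∏ f : Fin Nf, ‖fermionDet (wilsonDirac (fundamentalRep (Fin 3)) U (reg.mcrit k + reg.a k * m f / reg.Zm k) 1)‖ := by
    intro U
    have hwf0 : 0 ≤ reg.a k * m f₀ / reg.Zm k := div_nonneg (mul_nonneg (reg.a_pos k).le hm0) (reg.Zm_pos k).le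
    have hwM0 : 0 ≤ reg.a k * M / reg.Zm k := div_nonneg (mul_nonneg (reg.a_pos k).le hM0) (reg.Zm_pos k).le
    by_cases hdet : fermionDet (wilsonDirac (fundamentalRep (Fin 3)) U (reg.mcrit k + reg.a k * m f₀ / reg.Zm k) 1) = 0
    · have hWz : (∏ f : Fin Nf, ‖fermionDet (wilsonDirac (fundamentalRep (Fin 3)) U (reg.mcrit k + reg.a k * m f / reg.Zm k) 1)‖) = 0 :=
        Finset.prod_eq_zero (Finset.mem_univ f₀) (by rw [hdet, norm_zero])
      rw [hWz, mul_zero, mul_zero, mul_zero, add_zero]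
    · rw [← add_mul]
      refine mul_le_mul_of_nonneg_right ?_ (Finset.prod_nonneg fun f _ => norm_nonneg _)
      have hatom : Multiset.countP (fun z : ℂ => z = ((-(reg.mcrit k + reg.a k * m f₀ / reg.Zm k) : ℝ) : ℂ))
          (wilsonDirac (fundamentalRep (Fin 3)) U 0 1).charpoly.roots = 0 :=
        Multiset.countP_eq_zero.2 fun z hz h => hdet (fermionDet_eq_zero_of_root U _ hz h)
      have hZ := tight_integrand_le_window_add_realModes U (reg.mcrit k) (reg.a k * m f₀ / reg.Zm k)
        (reg.a k * M / reg.Zm k) hwf0 hwM0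
      rw [countP_realModes_le_eq U, hatom, add_zero] at hZ
      have hRe : |(Multiset.countP (fun z : ℂ => z.re < 0) (spinorLift gammaFive * wilsonDirac (fundamentalRep (Fin 3)) U (reg.mcrit k - reg.a k * M / reg.Zm k) 1).charpoly.roots : ℝ) - 6 * (2 * reg.L k + 1 : ℝ) ^ 4| ≤
          (Multiset.countP (fun z : ℂ => |z.re| ≤ reg.a k * m f₀ / reg.Zm k + reg.a k * M / reg.Zm k) (spinorLift gammaFive * wilsonDirac (fundamentalRep (Fin 3)) U (reg.mcrit k + reg.a k * m f₀ / reg.Zm k) 1).charpoly.roots : ℝ) +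
            (Multiset.countP (fun z : ℂ => z.im = 0 ∧ z.re < -(reg.mcrit k + reg.a k * m f₀ / reg.Zm k)) (wilsonDirac (fundamentalRep (Fin 3)) U 0 1).charpoly.roots : ℝ) := by
        exact_mod_cast hZ
      have hsum := hsign U
      linarith
  have hle := tightRatio_le_mean_add_extinctRatio reg c k (reg.L k) m M
    (measurable_windowCount (reg.mcrit k + reg.a k * m f₀ / reg.Zm k) (reg.a k * m f₀ / reg.Zm k + reg.a k * M / reg.Zm k))
    (fun U => countP_roots_charpoly_le_card _ _) hpt
  linarith

/-- **THE EXTENSIVE PIN, real-mode currency**: eventually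
`E₊ #{real λ(D_W(U,0,1)) ∈ [−m_{f₀}(k), −m_crit(k) + a_kM/Z_k]} ≥ max 1 (η (a_k(2L_k+1))²) − ε` on the scheme torus —
a DIVERGENT number of real modes of the massless Wilson operator in a band of bare width `a_k(m_{f₀}+M)/Z_k → 0`
at the line, while EXTINCT(a) empties everything below `−m_{f₀}(k)`. -/
theorem eventually_floor_le_bandMean (reg : QCDRegularisation Nf) {M₀ c : ℝ} (hM₀ : 0 ≤ M₀)
    {m : Fin Nf → ℝ} (hm : ∀ f, M₀ < m f) (hE : Extinct Nf reg c m) {η : ℝ}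
    (hT : ∀ M : ℝ, M₀ < M → ∀ᶠ k : ℕ in Filter.atTop,
      max 1 (η * (reg.a k * (2 * reg.L k + 1 : ℝ)) ^ 2) ≤ tightRatio reg k (reg.L k) m M)
    (f₀ : Fin Nf) {M : ℝ} (hM : M₀ < M) {ε : ℝ} (hε : 0 < ε) :
    ∀ᶠ k : ℕ in Filter.atTop, max 1 (η * (reg.a k * (2 * reg.L k + 1 : ℝ)) ^ 2) - ε ≤
      (∫ U, (Multiset.countP (fun z : ℂ => z.im = 0 ∧ -(reg.mcrit k + reg.a k * m f₀ / reg.Zm k) ≤ z.re ∧ z.re ≤ -(reg.mcrit k - reg.a k * M / reg.Zm k)) (wilsonDirac (fundamentalRep (Fin 3)) U 0 1).charpoly.roots : ℝ) * ∏ f : Fin Nf, ‖fermionDet (wilsonDirac (fundamentalRep (Fin 3)) U (reg.mcrit k + reg.a k * m f / reg.Zm k) 1)‖ ∂(wilsonMeasure (d := 4) (L := 2 * reg.L k + 1) (fundamentalRep (Fin 3)) (reg.β k))) / (∫ U, ∏ f : Fin Nf, ‖fermionDet (wilsonDirac (fundamentalRep (Fin 3)) U (reg.mcrit k + reg.a k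 * m f / reg.Zm k) 1)‖ ∂(wilsonMeasure (d := 4) (L := 2 * reg.L k + 1) (fundamentalRep (Fin 3)) (reg.β k))) := by
  filter_upwards [hE ε hε, hT M hM] with k hEk hTk
  have hE' : extinctRatio reg c k (reg.L k) m ≤ ε * ((2 * (reg.L k : ℕ) + 1 : ℝ) / (2 * reg.L k + 1)) ^ 4 :=
    hEk (reg.L k) le_rfl
  have hone : ((2 * (reg.L k : ℕ) + 1 : ℝ) / (2 * reg.L k + 1)) = 1 := div_self (by positivity)
  rw [hone, one_pow, mul_one] at hE'
  have hm0 : 0 ≤ m f₀ := by linarith [hm f₀]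
  have hM0 : 0 ≤ M := by linarith
  have hflav : ∀ U : GaugeConfig 4 (2 * reg.L k + 1) SU3, (Multiset.countP (fun z : ℂ => z.im = 0 ∧ z.re < -(reg.mcrit k + reg.a k * m f₀ / reg.Zm k)) (wilsonDirac (fundamentalRep (Fin 3)) U 0 1).charpoly.roots : ℝ) + (Multiset.countP (fun z : ℂ => |z.re| < c * (reg.a k * m f₀ / reg.Zm k)) (spinorLift gammaFive * wilsonDirac (fundamentalRep (Fin 3)) U (reg.mcrit k + reg.a k * m f₀ / reg.Zm k) 1).charpoly.roots : ℝ) ≤ (∑ f : Fin Nf, ((Multiset.countP (fun z : ℂ => z.im = 0 ∧ z.re < -(reg.mcrit k + reg.a k * m f / reg.Zm k)) (wilsonDirac (fundamentalRep (Fin 3)) U 0 1).charpoly.roots : ℝ) + (Multiset.countP (fun z : ℂ => |z.re| < c * (reg.a k * m f / reg.Zm k)) (spinorLift gammaFive * wilsonDirac (fundamentalRep (Fin 3)) U (reg.mcrit k + reg.a k * m f / reg.Zm k) 1).charpoly.roots : ℝ))) := fun U =>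
    Finset.single_le_sum (f := fun f : Fin Nf => ((Multiset.countP (fun z : ℂ => z.im = 0 ∧ z.re < -(reg.mcrit k + reg.a k * m f / reg.Zm k)) (wilsonDirac (fundamentalRep (Fin 3)) U 0 1).charpoly.roots : ℝ) + (Multiset.countP (fun z : ℂ => |z.re| < c * (reg.a k * m f / reg.Zm k)) (spinorLift gammaFive * wilsonDirac (fundamentalRep (Fin 3)) U (reg.mcrit k + reg.a k * m f / reg.Zm k) 1).charpoly.roots : ℝ)))
      (fun _ _ => add_nonneg (Nat.cast_nonneg _) (Nat.cast_nonneg _)) (Finset.mem_univ f₀)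
  have hsign : ∀ U : GaugeConfig 4 (2 * reg.L k + 1) SU3, (Multiset.countP (fun z : ℂ => z.im = 0 ∧ z.re < -(reg.mcrit k + reg.a k * m f₀ / reg.Zm k)) (wilsonDirac (fundamentalRep (Fin 3)) U 0 1).charpoly.roots : ℝ) ≤ (∑ f : Fin Nf, ((Multiset.countP (fun z : ℂ => z.im = 0 ∧ z.re < -(reg.mcrit k + reg.a k * m f / reg.Zm k)) (wilsonDirac (fundamentalRep (Fin 3)) U 0 1).charpoly.roots : ℝ) + (Multiset.countP (fun z : ℂ => |z.re| < c * (reg.a k * m f / reg.Zm k)) (spinorLift gammaFive * wilsonDirac (fundamentalRep (Fin 3)) U (reg.mcrit k + reg.a k * m f / reg.Zm k) 1).charpoly.roots : ℝ))) := fun U =>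
    le_trans (le_add_of_nonneg_right (Nat.cast_nonneg _)) (hflav U)
  have hpt : ∀ U : GaugeConfig 4 (2 * reg.L k + 1) SU3, |(Multiset.countP (fun z : ℂ => z.re < 0) (spinorLift gammaFive * wilsonDirac (fundamentalRep (Fin 3)) U (reg.mcrit k - reg.a k * M / reg.Zm k) 1).charpoly.roots : ℝ) - 6 * (2 * reg.L k + 1 : ℝ) ^ 4| * ∏ f : Fin Nf, ‖fermionDet (wilsonDirac (fundamentalRep (Fin 3)) U (reg.mcrit k + reg.a k * m f / reg.Zm k) 1)‖ ≤
      (Multiset.countP (fun z : ℂ => z.im = 0 ∧ -(reg.mcrit k + reg.a k * m f₀ / reg.Zm k) ≤ z.re ∧ z.re ≤ -(reg.mcrit k - reg.a k * M / reg.Zm k)) (wilsonDirac (fundamentalRep (Fin 3)) U 0 1).charpoly.roots : ℝ) * ∏ f : Fin Nf, ‖fermionDet (wilsonDirac (fundamentalRep (Fin 3)) U (reg.mcrit k + reg.a k * m f / reg.Zm k) 1)‖ + (∑ f : Fin Nf, ((Multiset.countP (fun z : ℂ => z.im = 0 ∧ z.re < -(reg.mcrit k + reg.a k * m f / reg.Zm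 k)) (wilsonDirac (fundamentalRep (Fin 3)) U 0 1).charpoly.roots : ℝ) + (Multiset.countP (fun z : ℂ => |z.re| < c * (reg.a k * m f / reg.Zm k)) (spinorLift gammaFive * wilsonDirac (fundamentalRep (Fin 3)) U (reg.mcrit k + reg.a k * m f / reg.Zm k) 1).charpoly.roots : ℝ))) * ∏ f : Fin Nf, ‖fermionDet (wilsonDirac (fundamentalRep (Fin 3)) U (reg.mcrit k + reg.a k * m f / reg.Zm k) 1)‖ := by
    intro U
    have hwf0 : 0 ≤ reg.a k * m f₀ / reg.Zm k := div_nonneg (mul_nonneg (reg.a_pos k).le hm0) (reg.Zm_pos k).le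
    have hwM0 : 0 ≤ reg.a k * M / reg.Zm k := div_nonneg (mul_nonneg (reg.a_pos k).le hM0) (reg.Zm_pos k).le
    rw [← add_mul]
    refine mul_le_mul_of_nonneg_right ?_ (Finset.prod_nonneg fun f _ => norm_nonneg _)
    have hZ := tight_integrand_le_signDefects_add_band U (reg.mcrit k) (reg.a k * m f₀ / reg.Zm k)
      (reg.a k * M / reg.Zm k) hwf0 hwM0
    have hRe : |(Multiset.countP (fun z : ℂ => z.re < 0) (spinorLift gammaFive * wilsonDirac (fundamentalRep (Fin 3)) U (reg.mcrit k - reg.a k * M / reg.Zm k) 1).charpoly.roots : ℝ) - 6 * (2 * reg.L k + 1 : ℝ) ^ 4| ≤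
        (Multiset.countP (fun z : ℂ => z.im = 0 ∧ z.re < -(reg.mcrit k + reg.a k * m f₀ / reg.Zm k)) (wilsonDirac (fundamentalRep (Fin 3)) U 0 1).charpoly.roots : ℝ) +
          (Multiset.countP (fun z : ℂ => z.im = 0 ∧ -(reg.mcrit k + reg.a k * m f₀ / reg.Zm k) ≤ z.re ∧ z.re ≤ -(reg.mcrit k - reg.a k * M / reg.Zm k)) (wilsonDirac (fundamentalRep (Fin 3)) U 0 1).charpoly.roots : ℝ) := by
      exact_mod_cast hZ
    have hsum := hsign U
    linarith
  have hle := tightRatio_le_mean_add_extinctRatio reg c k (reg.L k) m M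
    (measurable_bandCount (-(reg.mcrit k + reg.a k * m f₀ / reg.Zm k)) (-(reg.mcrit k - reg.a k * M / reg.Zm k)))
    (fun U => countP_roots_charpoly_le_card _ _) hpt
  linarith

/-- **THE EXTENSIVE PIN, unitary-shell currency**: eventually
`E₊ #{λ(Γ₅D_W(U, m_{f₀}(k), 1)) : c·a_k m_{f₀}/Z_k ≤ |λ| ≤ a_k(m_{f₀}+M)/Z_k} ≥ max 1 (η (a_k(2L_k+1))²) − ε` —
EXTINCT(b) clears the inner collar, TIGHT⁺ fills the shell around it extensively: the coercivity
`‖(D_W + m_f(k))⁻¹‖ ≤ Z_k/(c a_k m_f)` the bridge may extract is attained at scale, by `≳ η√V_phys` modes. -/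
theorem eventually_floor_le_shellMean (reg : QCDRegularisation Nf) {M₀ c : ℝ} (hM₀ : 0 ≤ M₀)
    {m : Fin Nf → ℝ} (hm : ∀ f, M₀ < m f) (hE : Extinct Nf reg c m) {η : ℝ}
    (hT : ∀ M : ℝ, M₀ < M → ∀ᶠ k : ℕ in Filter.atTop,
      max 1 (η * (reg.a k * (2 * reg.L k + 1 : ℝ)) ^ 2) ≤ tightRatio reg k (reg.L k) m M)
    (f₀ : Fin Nf) {M : ℝ} (hM : M₀ < M) {ε : ℝ} (hε : 0 < ε) :
    ∀ᶠ k : ℕ in Filter.atTop, max 1 (η * (reg.a k * (2 * reg.L k + 1 : ℝ)) ^ 2) - ε ≤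
      (∫ U, (Multiset.countP (fun z : ℂ => c * (reg.a k * m f₀ / reg.Zm k) ≤ |z.re| ∧ |z.re| ≤ reg.a k * m f₀ / reg.Zm k + reg.a k * M / reg.Zm k) (spinorLift gammaFive * wilsonDirac (fundamentalRep (Fin 3)) U (reg.mcrit k + reg.a k * m f₀ / reg.Zm k) 1).charpoly.roots : ℝ) * ∏ f : Fin Nf, ‖fermionDet (wilsonDirac (fundamentalRep (Fin 3)) U (reg.mcrit k + reg.a k * m f / reg.Zm k) 1)‖ ∂(wilsonMeasure (d := 4) (L := 2 * reg.L k + 1) (fundamentalRep (Fin 3)) (reg.β k))) / (∫ U, ∏ f : Fin Nf, ‖fermionDet (wilsonDirac (fundamentalRep (Fin 3)) U (reg.mcrit k + reg.a k * m f / reg.Zm k) 1)‖ ∂(wilsonMeasure (d := 4) (L := 2 * reg.L k + 1) (fundamentalRep (Fin 3)) (reg.β k))) := by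
  filter_upwards [hE ε hε, hT M hM] with k hEk hTk
  have hE' : extinctRatio reg c k (reg.L k) m ≤ ε * ((2 * (reg.L k : ℕ) + 1 : ℝ) / (2 * reg.L k + 1)) ^ 4 :=
    hEk (reg.L k) le_rfl
  have hone : ((2 * (reg.L k : ℕ) + 1 : ℝ) / (2 * reg.L k + 1)) = 1 := div_self (by positivity)
  rw [hone, one_pow, mul_one] at hE'
  have hm0 : 0 ≤ m f₀ := by linarith [hm f₀]
  have hM0 : 0 ≤ M := by linarith
  have hflav : ∀ U : GaugeConfig 4 (2 * reg.L k + 1) SU3, (Multiset.countP (fun z : ℂ => z.im = 0 ∧ z.re < -(reg.mcrit k + reg.a k * m f₀ / reg.Zm k)) (wilsonDirac (fundamentalRep (Fin 3)) U 0 1).charpoly.roots : ℝ) + (Multiset.countP (fun z : ℂ => |z.re| < c * (reg.a k * m f₀ / reg.Zm k)) (spinorLift gammaFive * wilsonDirac (fundamentalRep (Fin 3)) U (reg.mcrit k + reg.a k * m f₀ / reg.Zm k) 1).charpoly.roots : ℝ) ≤ (∑ f : Fin Nf, ((Multiset.countP (fun z : ℂ => z.im = 0 ∧ z.re < -(reg.mcrit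 k + reg.a k * m f / reg.Zm k)) (wilsonDirac (fundamentalRep (Fin 3)) U 0 1).charpoly.roots : ℝ) + (Multiset.countP (fun z : ℂ => |z.re| < c * (reg.a k * m f / reg.Zm k)) (spinorLift gammaFive * wilsonDirac (fundamentalRep (Fin 3)) U (reg.mcrit k + reg.a k * m f / reg.Zm k) 1).charpoly.roots : ℝ))) := fun U =>
    Finset.single_le_sum (f := fun f : Fin Nf => ((Multiset.countP (fun z : ℂ => z.im = 0 ∧ z.re < -(reg.mcrit k + reg.a k * m f / reg.Zm k)) (wilsonDirac (fundamentalRep (Fin 3)) U 0 1).charpoly.roots : ℝ) + (Multiset.countP (fun z : ℂ => |z.re| < c * (reg.a k * m f / reg.Zm k)) (spinorLift gammaFive * wilsonDirac (fundamentalRep (Fin 3)) U (reg.mcrit k + reg.a k * m f / reg.Zm k) 1).charpoly.roots : ℝ)))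
      (fun _ _ => add_nonneg (Nat.cast_nonneg _) (Nat.cast_nonneg _)) (Finset.mem_univ f₀)
  have hsign : ∀ U : GaugeConfig 4 (2 * reg.L k + 1) SU3, (Multiset.countP (fun z : ℂ => z.im = 0 ∧ z.re < -(reg.mcrit k + reg.a k * m f₀ / reg.Zm k)) (wilsonDirac (fundamentalRep (Fin 3)) U 0 1).charpoly.roots : ℝ) ≤ (∑ f : Fin Nf, ((Multiset.countP (fun z : ℂ => z.im = 0 ∧ z.re < -(reg.mcrit k + reg.a k * m f / reg.Zm k)) (wilsonDirac (fundamentalRep (Fin 3)) U 0 1).charpoly.roots : ℝ) + (Multiset.countP (fun z : ℂ => |z.re| < c * (reg.a k * m f / reg.Zm k)) (spinorLift gammaFive * wilsonDirac (fundamentalRep (Fin 3)) U (reg.mcrit k + reg.a k * m f / reg.Zm k) 1).charpoly.roots : ℝ))) := fun U =>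
    le_trans (le_add_of_nonneg_right (Nat.cast_nonneg _)) (hflav U)
  have hpt : ∀ U : GaugeConfig 4 (2 * reg.L k + 1) SU3, |(Multiset.countP (fun z : ℂ => z.re < 0) (spinorLift gammaFive * wilsonDirac (fundamentalRep (Fin 3)) U (reg.mcrit k - reg.a k * M / reg.Zm k) 1).charpoly.roots : ℝ) - 6 * (2 * reg.L k + 1 : ℝ) ^ 4| * ∏ f : Fin Nf, ‖fermionDet (wilsonDirac (fundamentalRep (Fin 3)) U (reg.mcrit k + reg.a k * m f / reg.Zm k) 1)‖ ≤
      (Multiset.countP (fun z : ℂ => c * (reg.a k * m f₀ / reg.Zm k) ≤ |z.re| ∧ |z.re| ≤ reg.a k * m f₀ / reg.Zm k + reg.a k * M / reg.Zm k) (spinorLift gammaFive * wilsonDirac (fundamentalRep (Fin 3)) U (reg.mcrit k + reg.a k * m f₀ / reg.Zm k) 1).charpoly.roots : ℝ) * ∏ f : Fin Nf, ‖fermionDet (wilsonDirac (fundamentalRep (Fin 3)) U (reg.mcrit k + reg.a k * m f / reg.Zm k) 1)‖ + (∑ f : Fin Nf, ((Multiset.countP (fun z : ℂ => z.im = 0 ∧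 z.re < -(reg.mcrit k + reg.a k * m f / reg.Zm k)) (wilsonDirac (fundamentalRep (Fin 3)) U 0 1).charpoly.roots : ℝ) + (Multiset.countP (fun z : ℂ => |z.re| < c * (reg.a k * m f / reg.Zm k)) (spinorLift gammaFive * wilsonDirac (fundamentalRep (Fin 3)) U (reg.mcrit k + reg.a k * m f / reg.Zm k) 1).charpoly.roots : ℝ))) * ∏ f : Fin Nf, ‖fermionDet (wilsonDirac (fundamentalRep (Fin 3)) U (reg.mcrit k + reg.a k * m f / reg.Zm k) 1)‖ := by
    intro U
    have hwf0 : 0 ≤ reg.a k * m f₀ / reg.Zm k := div_nonneg (mul_nonneg (reg.a_pos k).le hm0) (reg.Zm_pos k).le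
    have hwM0 : 0 ≤ reg.a k * M / reg.Zm k := div_nonneg (mul_nonneg (reg.a_pos k).le hM0) (reg.Zm_pos k).le
    by_cases hdet : fermionDet (wilsonDirac (fundamentalRep (Fin 3)) U (reg.mcrit k + reg.a k * m f₀ / reg.Zm k) 1) = 0
    · have hWz : (∏ f : Fin Nf, ‖fermionDet (wilsonDirac (fundamentalRep (Fin 3)) U (reg.mcrit k + reg.a k * m f / reg.Zm k) 1)‖) = 0 :=
        Finset.prod_eq_zero (Finset.mem_univ f₀) (by rw [hdet, norm_zero])
      rw [hWz, mul_zero, mul_zero, mul_zero, add_zero]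
    · rw [← add_mul]
      refine mul_le_mul_of_nonneg_right ?_ (Finset.prod_nonneg fun f _ => norm_nonneg _)
      have hatom : Multiset.countP (fun z : ℂ => z = ((-(reg.mcrit k + reg.a k * m f₀ / reg.Zm k) : ℝ) : ℂ))
          (wilsonDirac (fundamentalRep (Fin 3)) U 0 1).charpoly.roots = 0 :=
        Multiset.countP_eq_zero.2 fun z hz h => hdet (fermionDet_eq_zero_of_root U _ hz h)
      have hZ := tight_integrand_le_window_add_realModes U (reg.mcrit k) (reg.a k * m f₀ / reg.Zm k)
        (reg.a k * M / reg.Zm k) hwf0 hwM0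
      rw [countP_realModes_le_eq U, hatom, add_zero] at hZ
      have hRe : |(Multiset.countP (fun z : ℂ => z.re < 0) (spinorLift gammaFive * wilsonDirac (fundamentalRep (Fin 3)) U (reg.mcrit k - reg.a k * M / reg.Zm k) 1).charpoly.roots : ℝ) - 6 * (2 * reg.L k + 1 : ℝ) ^ 4| ≤
          (Multiset.countP (fun z : ℂ => |z.re| ≤ reg.a k * m f₀ / reg.Zm k + reg.a k * M / reg.Zm k) (spinorLift gammaFive * wilsonDirac (fundamentalRep (Fin 3)) U (reg.mcrit k + reg.a k * m f₀ / reg.Zm k) 1).charpoly.roots : ℝ) +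
            (Multiset.countP (fun z : ℂ => z.im = 0 ∧ z.re < -(reg.mcrit k + reg.a k * m f₀ / reg.Zm k)) (wilsonDirac (fundamentalRep (Fin 3)) U 0 1).charpoly.roots : ℝ) := by
        exact_mod_cast hZ
      have hsplit : (Multiset.countP (fun z : ℂ => |z.re| ≤ reg.a k * m f₀ / reg.Zm k + reg.a k * M / reg.Zm k) (spinorLift gammaFive * wilsonDirac (fundamentalRep (Fin 3)) U (reg.mcrit k + reg.a k * m f₀ / reg.Zm k) 1).charpoly.roots : ℝ) ≤
          (Multiset.countP (fun z : ℂ => c * (reg.a k * m f₀ / reg.Zm k) ≤ |z.re| ∧ |z.re| ≤ reg.a k * m f₀ / reg.Zm k + reg.a k * M / reg.Zm k) (spinorLift gammaFive * wilsonDirac (fundamentalRep (Fin 3)) U (reg.mcrit k + reg.a k * m f₀ / reg.Zm k) 1).charpoly.roots : ℝ) +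
            (Multiset.countP (fun z : ℂ => |z.re| < c * (reg.a k * m f₀ / reg.Zm k)) (spinorLift gammaFive * wilsonDirac (fundamentalRep (Fin 3)) U (reg.mcrit k + reg.a k * m f₀ / reg.Zm k) 1).charpoly.roots : ℝ) := by
        have hnat : ∀ (s : Multiset ℂ),
            s.countP (fun z : ℂ => |z.re| ≤ reg.a k * m f₀ / reg.Zm k + reg.a k * M / reg.Zm k) ≤
              s.countP (fun z : ℂ => c * (reg.a k * m f₀ / reg.Zm k) ≤ |z.re| ∧ |z.re| ≤ reg.a k * m f₀ / reg.Zm k + reg.a k * M / reg.Zm k) +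
                s.countP (fun z : ℂ => |z.re| < c * (reg.a k * m f₀ / reg.Zm k)) := by
          intro s
          induction s using Multiset.induction_on with
          | empty => simp
          | cons a s ih =>
            simp only [Multiset.countP_cons]
            by_cases hp : |a.re| ≤ reg.a k * m f₀ / reg.Zm k + reg.a k * M / reg.Zm k
            · rcases le_or_gt (c * (reg.a k * m f₀ / reg.Zm k)) |a.re| with hq | hr
              · rw [if_pos hp, if_pos (show c * (reg.a k * m f₀ / reg.Zm k) ≤ |a.re| ∧ |a.re| ≤ reg.a k * m f₀ / reg.Zm k + reg.a k * M / reg.Zm k from ⟨hq, hp⟩)]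
                split_ifs <;> omega
              · rw [if_pos hp, if_pos hr]; split_ifs <;> omega
            · rw [if_neg hp]; split_ifs <;> omega
        exact_mod_cast hnat _
      have hsum := hflav U
      linarith
  have hle := tightRatio_le_mean_add_extinctRatio reg c k (reg.L k) m M
    (measurable_shellCount (reg.mcrit k + reg.a k * m f₀ / reg.Zm k) (c * (reg.a k * m f₀ / reg.Zm k)) (reg.a k * m f₀ / reg.Zm k + reg.a k * M / reg.Zm k))
    (fun U => countP_roots_charpoly_le_card _ _) hpt
  linarith

/-- **The window mean exceeds every constant eventually** (TIGHT⁺ ∧ EXTINCT; any flavour, any probe `M > M₀`). -/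
theorem eventually_le_windowMean (reg : QCDRegularisation Nf) {M₀ c : ℝ} (hM₀ : 0 ≤ M₀)
    {m : Fin Nf → ℝ} (hm : ∀ f, M₀ < m f) (hE : Extinct Nf reg c m) (hT : (∃ η : ℝ, 0 < η ∧ ∀ M : ℝ, M₀ < M → ∀ᶠ k : ℕ in Filter.atTop, max 1 (η * (reg.a k * (2 * reg.L k + 1 : ℝ)) ^ 2) ≤ tightRatio reg k (reg.L k) m M))
    (f₀ : Fin Nf) {M : ℝ} (hM : M₀ < M) (C : ℝ) :
    ∀ᶠ k : ℕ in Filter.atTop, C ≤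
      (∫ U, (Multiset.countP (fun z : ℂ => |z.re| ≤ reg.a k * m f₀ / reg.Zm k + reg.a k * M / reg.Zm k) (spinorLift gammaFive * wilsonDirac (fundamentalRep (Fin 3)) U (reg.mcrit k + reg.a k * m f₀ / reg.Zm k) 1).charpoly.roots : ℝ) * ∏ f : Fin Nf, ‖fermionDet (wilsonDirac (fundamentalRep (Fin 3)) U (reg.mcrit k + reg.a k * m f / reg.Zm k) 1)‖ ∂(wilsonMeasure (d := 4) (L := 2 * reg.L k + 1) (fundamentalRep (Fin 3)) (reg.β k))) / (∫ U, ∏ f : Fin Nf, ‖fermionDet (wilsonDirac (fundamentalRep (Fin 3)) U (reg.mcrit k + reg.a k * m f / reg.Zm k) 1)‖ ∂(wilsonMeasure (d := 4) (L := 2 * reg.L k + 1) (fundamentalRep (Fin 3)) (reg.β k))) := by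
  obtain ⟨η, hη, hT⟩ := hT
  filter_upwards [eventually_floor_le_windowMean reg hM₀ hm hE hT f₀ hM one_pos,
    (tendsto_tightFloor_atTop reg hη).eventually_ge_atTop (C + 1)] with k hk hC
  linarith

/-- **The band mean exceeds every constant eventually.** -/
theorem eventually_le_bandMean (reg : QCDRegularisation Nf) {M₀ c : ℝ} (hM₀ : 0 ≤ M₀)
    {m : Fin Nf → ℝ} (hm : ∀ f, M₀ < m f) (hE : Extinct Nf reg c m) (hT : (∃ η : ℝ, 0 < η ∧ ∀ M : ℝ, M₀ < M → ∀ᶠ k : ℕ in Filter.atTop, max 1 (η * (reg.a k * (2 * reg.L k + 1 : ℝ)) ^ 2) ≤ tightRatio reg k (reg.L k) m M))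
    (f₀ : Fin Nf) {M : ℝ} (hM : M₀ < M) (C : ℝ) :
    ∀ᶠ k : ℕ in Filter.atTop, C ≤
      (∫ U, (Multiset.countP (fun z : ℂ => z.im = 0 ∧ -(reg.mcrit k + reg.a k * m f₀ / reg.Zm k) ≤ z.re ∧ z.re ≤ -(reg.mcrit k - reg.a k * M / reg.Zm k)) (wilsonDirac (fundamentalRep (Fin 3)) U 0 1).charpoly.roots : ℝ) * ∏ f : Fin Nf, ‖fermionDet (wilsonDirac (fundamentalRep (Fin 3)) U (reg.mcrit k + reg.a k * m f / reg.Zm k) 1)‖ ∂(wilsonMeasure (d := 4) (L := 2 * reg.L k + 1) (fundamentalRep (Fin 3)) (reg.β k))) / (∫ U, ∏ f : Fin Nf, ‖fermionDet (wilsonDirac (fundamentalRep (Fin 3)) U (reg.mcrit k + reg.a k * m f / reg.Zm k) 1)‖ ∂(wilsonMeasure (d := 4) (L := 2 * reg.L k + 1) (fundamentalRep (Fin 3)) (reg.β k))) := by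
  obtain ⟨η, hη, hT⟩ := hT
  filter_upwards [eventually_floor_le_bandMean reg hM₀ hm hE hT f₀ hM one_pos,
    (tendsto_tightFloor_atTop reg hη).eventually_ge_atTop (C + 1)] with k hk hC
  linarith

/-- **The shell mean exceeds every constant eventually.** -/
theorem eventually_le_shellMean (reg : QCDRegularisation Nf) {M₀ c : ℝ} (hM₀ : 0 ≤ M₀)
    {m : Fin Nf → ℝ} (hm : ∀ f, M₀ < m f) (hE : Extinct Nf reg c m) (hT : (∃ η : ℝ, 0 < η ∧ ∀ M : ℝ, M₀ < M → ∀ᶠ k : ℕ in Filter.atTop, max 1 (η * (reg.a k * (2 * reg.L k + 1 : ℝ)) ^ 2) ≤ tightRatio reg k (reg.L k) m M))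
    (f₀ : Fin Nf) {M : ℝ} (hM : M₀ < M) (C : ℝ) :
    ∀ᶠ k : ℕ in Filter.atTop, C ≤
      (∫ U, (Multiset.countP (fun z : ℂ => c * (reg.a k * m f₀ / reg.Zm k) ≤ |z.re| ∧ |z.re| ≤ reg.a k * m f₀ / reg.Zm k + reg.a k * M / reg.Zm k) (spinorLift gammaFive * wilsonDirac (fundamentalRep (Fin 3)) U (reg.mcrit k + reg.a k * m f₀ / reg.Zm k) 1).charpoly.roots : ℝ) * ∏ f : Fin Nf, ‖fermionDet (wilsonDirac (fundamentalRep (Fin 3)) U (reg.mcrit k + reg.a k * m f / reg.Zm k) 1)‖ ∂(wilsonMeasure (d := 4) (L := 2 * reg.L k + 1) (fundamentalRep (Fin 3)) (reg.β k))) / (∫ U, ∏ f : Fin Nf, ‖fermionDet (wilsonDirac (fundamentalRep (Fin 3)) U (reg.mcrit k + reg.a k * m f / reg.Zm k) 1)‖ ∂(wilsonMeasure (d := 4) (L := 2 * reg.L k + 1) (fundamentalRep (Fin 3)) (reg.β k))) := by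
  obtain ⟨η, hη, hT⟩ := hT
  filter_upwards [eventually_floor_le_shellMean reg hM₀ hm hE hT f₀ hM one_pos,
    (tendsto_tightFloor_atTop reg hη).eventually_ge_atTop (C + 1)] with k hk hC
  linarith

/-! ## Reading for the restated cruxes -/

/-- **What the sibling crux hands the bridge prover.** Any witness `(reg, M₀, c)` of the restated
`WindowExtinction` (whose body at `N_f` is verbatim the hypothesis SD⁺(N_f) of `ExtinctionBuildsQCD`) has
`c ≤ 1`, and for every tuple above `M₀`, every flavour, every probe `M > M₀` and every constant `C`: eventually in
`k` the window, band and shell means on the scheme torus are all `≥ C` — the line is critical with a divergent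
number of near-zero modes of `Γ₅D_W` at the flavour mass (cap and branch are not used). -/
theorem windowExtinction_extensive_pin (h : WindowExtinction) {Nf : ℕ} (hNf : Nf = 2 ∨ Nf = 3) :
    ∃ reg : QCDRegularisation Nf, ∃ M₀ : ℝ, 0 ≤ M₀ ∧ ∃ c : ℝ, 0 < c ∧ c ≤ 1 ∧
      ∀ m : Fin Nf → ℝ, (∀ f, M₀ < m f) → Extinct Nf reg c m ∧ (∃ η : ℝ, 0 < η ∧ ∀ M : ℝ, M₀ < M → ∀ᶠ k : ℕ in Filter.atTop, max 1 (η * (reg.a k * (2 * reg.L k + 1 : ℝ)) ^ 2) ≤ tightRatio reg k (reg.L k) m M) ∧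
        ∀ (f₀ : Fin Nf) (M : ℝ), M₀ < M → ∀ C : ℝ, ∀ᶠ k : ℕ in Filter.atTop,
          C ≤ (∫ U, (Multiset.countP (fun z : ℂ => |z.re| ≤ reg.a k * m f₀ / reg.Zm k + reg.a k * M / reg.Zm k) (spinorLift gammaFive * wilsonDirac (fundamentalRep (Fin 3)) U (reg.mcrit k + reg.a k * m f₀ / reg.Zm k) 1).charpoly.roots : ℝ) * ∏ f : Fin Nf, ‖fermionDet (wilsonDirac (fundamentalRep (Fin 3)) U (reg.mcrit k + reg.a k * m f / reg.Zm k) 1)‖ ∂(wilsonMeasure (d := 4) (L := 2 * reg.L k + 1) (fundamentalRep (Fin 3)) (reg.β k))) / (∫ U, ∏ f : Fin Nf, ‖fermionDet (wilsonDirac (fundamentalRep (Fin 3)) U (reg.mcrit k + reg.a k * m f / reg.Zm k) 1)‖ ∂(wilsonMeasure (d := 4) (L := 2 * reg.L k + 1) (fundamentalRep (Fin 3)) (reg.β k))) ∧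
          C ≤ (∫ U, (Multiset.countP (fun z : ℂ => z.im = 0 ∧ -(reg.mcrit k + reg.a k * m f₀ / reg.Zm k) ≤ z.re ∧ z.re ≤ -(reg.mcrit k - reg.a k * M / reg.Zm k)) (wilsonDirac (fundamentalRep (Fin 3)) U 0 1).charpoly.roots : ℝ) * ∏ f : Fin Nf, ‖fermionDet (wilsonDirac (fundamentalRep (Fin 3)) U (reg.mcrit k + reg.a k * m f / reg.Zm k) 1)‖ ∂(wilsonMeasure (d := 4) (L := 2 * reg.L k + 1) (fundamentalRep (Fin 3)) (reg.β k))) / (∫ U, ∏ f : Fin Nf, ‖fermionDet (wilsonDirac (fundamentalRep (Fin 3)) U (reg.mcrit k + reg.a k * m f / reg.Zm k) 1)‖ ∂(wilsonMeasure (d := 4) (L := 2 * reg.L k + 1) (fundamentalRep (Fin 3)) (reg.β k))) ∧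
          C ≤ (∫ U, (Multiset.countP (fun z : ℂ => c * (reg.a k * m f₀ / reg.Zm k) ≤ |z.re| ∧ |z.re| ≤ reg.a k * m f₀ / reg.Zm k + reg.a k * M / reg.Zm k) (spinorLift gammaFive * wilsonDirac (fundamentalRep (Fin 3)) U (reg.mcrit k + reg.a k * m f₀ / reg.Zm k) 1).charpoly.roots : ℝ) * ∏ f : Fin Nf, ‖fermionDet (wilsonDirac (fundamentalRep (Fin 3)) U (reg.mcrit k + reg.a k * m f / reg.Zm k) 1)‖ ∂(wilsonMeasure (d := 4) (L := 2 * reg.L k + 1) (fundamentalRep (Fin 3)) (reg.β k))) / (∫ U, ∏ f : Fin Nf, ‖fermionDet (wilsonDirac (fundamentalRep (Fin 3)) U (reg.mcrit k + reg.a k * m f / reg.Zm k) 1)‖ ∂(wilsonMeasure (d := 4) (L := 2 * reg.L k + 1) (fundamentalRep (Fin 3)) (reg.β k))) := by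
  obtain ⟨reg, -, -, -, -, M₀, hM₀, c, hc, hw⟩ := h Nf hNf
  have hNf' : 0 < Nf := by rcases hNf with rfl | rfl <;> norm_num
  have hw' : ∀ m : Fin Nf → ℝ, (∀ f, M₀ < m f) → Extinct Nf reg c m ∧ (∃ η : ℝ, 0 < η ∧ ∀ M : ℝ, M₀ < M → ∀ᶠ k : ℕ in Filter.atTop, max 1 (η * (reg.a k * (2 * reg.L k + 1 : ℝ)) ^ 2) ≤ tightRatio reg k (reg.L k) m M) :=
    fun m hm => hw m hm
  refine ⟨reg, M₀, hM₀, c, hc, SDHyp.c_le_one hNf' hM₀ (fun m hm => ⟨(hw' m hm).1,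
    tight_of_tightPlus' (hw' m hm).2⟩), fun m hm => ⟨(hw' m hm).1, (hw' m hm).2, fun f₀ M hM C => ?_⟩⟩
  exact (eventually_le_windowMean reg hM₀ hm (hw' m hm).1 (hw' m hm).2 f₀ hM C).and
    ((eventually_le_bandMean reg hM₀ hm (hw' m hm).1 (hw' m hm).2 f₀ hM C).and
      (eventually_le_shellMean reg hM₀ hm (hw' m hm).1 (hw' m hm).2 f₀ hM C))

end Summit.QuantumFields.QCD.Theorems.ExtinctionBuildsQCD.Negative.ExtensivePin

end
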